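import Summits.HodgeConjecture.CorCM.IrreducibleOddWeightsCMTypes
import HarnessLib

/-!
# The capacity dichotomy: WITHOUT multiplicity one — irreducible odd weights or not — a nondegenerate same-slot family
# of CM types has at most `n/2` members

COR-CM (cell `pub-hodgecm2`, binder seat `b16` gen 55, count-neutral claim IRR-ODD, file F5 — abstract `G`-set level,
sequel of F1/F1b `CorCM/IrreducibleOddWeights{,CMTypes}`; theorems only, no definition, no named fact, no `sorry`).  NEW
as stated, hence under `Summits/`.  HONEST FRAMING: finite-dimensional linear algebra about the Kubota–Dodson rank of
same-slot families of CM types (one CM field); `HC_CM` is neither used nor asserted.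

F1b proved the bound `2|I| ≤ n` (`|X| = 2n`) for nondegenerate same-slot families when the odd weights `Anti` are
IRREDUCIBLE but multiplicity one (M1) fails.  This file removes the irreducibility hypothesis: if `Anti` is REDUCIBLE —
a proper non-zero `G`-stable `W < Anti` exists — then the orthogonal projection `Q` onto `W` (for the `G`-invariant dot
product; equivariant, `exists_equivariant_projection`) and `id − Q` split `Anti = W ⊕ W′` into two stable summands, a
nondegenerate family has its type vectors projected to LINEARLY INDEPENDENT families in `W` and in `W′` (a vanishing
projection `Q u_i = 0` would put `U(Φ_i)` inside the proper stable `ker Q ∩ Anti`, contradicting nondegeneracy of the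
member), so `|I| ≤ dim W` and `|I| ≤ dim W′`, i.e. `2|I| ≤ n` again (`two_mul_card_le_of_reducible`).  Since (M1) implies
irreducibility (F1b `antiWeights_irreducible_of_multiplicityOne`), the two cases together give

> **`two_mul_card_le_of_not_multiplicityOne'`** — if multiplicity one of the odd weights FAILS (for a CM field: the field
> is not (SC), seat gen 54), EVERY nondegenerate same-slot family of CM types has `2|I| ≤ |X|/2`.

So the CAPACITY of a slot (the largest nondegenerate same-slot family) is `n` under (M1)/(SC) (tree:
`card_le_card_div_two_of_typeRank_sigmaType_eq`, and gen 54: any `≤ 3` pairwise non-opposite type vectors qualify) and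
AT MOST `n/2` otherwise — a factor-two gap with nothing in between.  Sequel F5b `CorCM/IrreducibleOddWeightsDichotomyCMFields`:
for ANY CM field that is not (SC), more than `[K:ℚ]/4` pairwise non-isogenous simple abelian varieties with CM by it carry
an exceptional Hodge class on some product.

## References

* [Serre1977] J.-P. Serre, *Linear Representations of Finite Groups*, GTM 42 (1977), §1.3 Thm. 1 (stable complements),
  §2.2 Prop. 4.
* [Mai1989] L. Mai, *Lower bounds for the ranks of CM types*, J. Number Theory 32 (1989), §2 Prop. 1 (proof).
* [Gordon1999HodgeAVSurvey] B. B. Gordon, *A survey of the Hodge conjecture for abelian varieties*, 7.5–7.7.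
-/

set_option autoImplicit false

noncomputable section

open scoped BigOperators

universe u v w

namespace Summit.HodgeConjecture.CorCM.IrrOdd

open Literature.NumberTheory.ComplexMultiplication

variable {G : Type w} [Group G] {I : Type u} {X : Type v} [MulAction G X]

/-! ### §1 The equivariant projection onto a stable subspace -/

section Projection

variable [Fintype X]

/-- The dot product on `ℚ^X` is invariant under the permutations of `X` by `G`. [cite: Serre1977, §1.3 Thm. 1 (proof)] -/
theorem dotProduct_comp_smul (f f' : X → ℚ) (g : G) :
    (fun x => f (g • x)) ⬝ᵥ (fun x => f' (g • x)) = f ⬝ᵥ f' :=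
  Fintype.sum_equiv (MulAction.toPerm g) _ _ fun _ => rfl

/-- **The orthogonal projection onto a `G`-stable subspace `W ≤ ℚ^X` is `G`-equivariant**: there is a linear
`Q : ℚ^X → ℚ^X` with values in `W`, the identity on `W`, commuting with `G` (the orthogonal complement of a stable
subspace for the invariant positive definite dot product is stable). [cite: Serre1977, §1.3 Thm. 1] -/
theorem exists_equivariant_projection (W : Submodule ℚ (X → ℚ))
    (hWst : ∀ (k : G) (f : X → ℚ), f ∈ W → (fun y => f (k • y)) ∈ W) :
    ∃ Q : (X → ℚ) →ₗ[ℚ] (X → ℚ), (∀ (g : G) (f : X → ℚ), Q (fun x => f (g⁻¹ • x)) = fun x => Q f (g⁻¹ • x)) ∧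
      (∀ f, Q f ∈ W) ∧ ∀ w ∈ W, Q w = w := by
  -- the orthogonal complement and the decomposition
  have hcW : IsCompl W (LinearMap.BilinForm.orthogonal (dotProductBilin ℚ ℚ) W) := by
    refine LinearMap.BilinForm.isCompl_orthogonal_of_restrict_nondegenerate (fun x y h => ?_)
      ⟨fun m hm => ?_, fun m hm => ?_⟩
    · change x ⬝ᵥ y = 0 at h
      change y ⬝ᵥ x = 0
      rwa [dotProduct_comm]
    all_goals
      have h := hm m
      rw [LinearMap.BilinForm.restrict_apply] at h
      change (m : X → ℚ) ⬝ᵥ (m : X → ℚ) = 0 at h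
      exact Subtype.ext (dotProduct_self_eq_zero.1 h)
  have horth : ∀ {m : X → ℚ}, m ∈ LinearMap.BilinForm.orthogonal (dotProductBilin ℚ ℚ) W → ∀ g : G,
      (fun x => m (g • x)) ∈ LinearMap.BilinForm.orthogonal (dotProductBilin ℚ ℚ) W := by
    intro m hm g
    rw [LinearMap.BilinForm.mem_orthogonal_iff] at hm ⊢
    intro n hn
    have h1 := hm (fun x => n (g⁻¹ • x)) (hWst g⁻¹ n hn)
    change _ ⬝ᵥ _ = 0 at h1
    change n ⬝ᵥ _ = 0
    rw [← dotProduct_comp_smul (fun x => n (g⁻¹ • x)) m g] at h1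
    simpa only [inv_smul_smul] using h1
  let Q : (X → ℚ) →ₗ[ℚ] (X → ℚ) := W.subtype ∘ₗ W.projectionOnto _ hcW
  have hQ : ∀ p ∈ W, ∀ q ∈ LinearMap.BilinForm.orthogonal (dotProductBilin ℚ ℚ) W, Q (p + q) = p :=
    fun p hp q hq => by
      simp only [Q, LinearMap.comp_apply, map_add, Submodule.projectionOnto_apply_of_mem_left hcW hp,
        Submodule.projectionOnto_apply_of_mem_right hcW hq, Submodule.coe_subtype, Submodule.coe_zero, add_zero]
  refine ⟨Q, fun g f => ?_, fun f => (W.projectionOnto _ hcW f).2, fun w hw => ?_⟩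
  · obtain ⟨p, hp, q, hq, rfl⟩ := Submodule.mem_sup.1 (hcW.sup_eq_top.symm ▸ Submodule.mem_top (x := f))
    have hsplit : (fun x => (p + q) (g⁻¹ • x)) = (fun x => p (g⁻¹ • x)) + fun x => q (g⁻¹ • x) := rfl
    rw [hsplit, hQ _ (hWst g⁻¹ p hp) _ (horth hq g⁻¹), hQ p hp q hq]
  · simpa only [add_zero] using hQ w hw 0 (Submodule.zero_mem _)

end Projection

/-! ### §2 Reducible odd weights: two complementary projections, capacity `n/2` -/

section Reducible

variable [DecidableEq I] [Fintype I] [Fintype X] [Nonempty X]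

omit [Fintype X] [Nonempty X] in
/-- **The projected type vectors of an additive family are linearly independent** — for an equivariant `Q : ℚ^X → ℚ^X`
that does not kill any `U(Φ_i)`: if `Σ_i c_i Q(u_i) = 0` then all `c_i = 0` (the evaluation criterion with
`φ_i = c_i Q`; `Q u_i = 0` would give `Q = 0` on `U(Φ_i)`). [cite: Mai1989, §2 Prop. 1 (proof)] -/
theorem linearIndependent_apply_antiVec_of_forall_map_slotExt_le (Φ : I → Set X)
    (hadd : ∀ i, (antiSpan G (Φ i)).map (slotExt (E := fun _ : I => X) i) ≤
      antiSpan G (sigmaType (E := fun _ : I => X) Φ))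
    (Q : (X → ℚ) →ₗ[ℚ] (X → ℚ)) (hQ : ∀ (g : G) (f : X → ℚ), Q (fun x => f (g⁻¹ • x)) = fun x => Q f (g⁻¹ • x))
    (hQu : ∀ i, Q (antiVec (Φ i) (1 : G)) ≠ 0) :
    LinearIndependent ℚ fun i => Q (antiVec (Φ i) (1 : G)) := by
  rw [Fintype.linearIndependent_iff]
  intro c hc i
  have h := apply_antiVec_eq_zero_of_forall_map_slotExt_le Φ hadd (fun j => c j • Q)
    (fun j g f => by simp only [LinearMap.smul_apply, hQ g f]; rfl)
    (by simpa only [LinearMap.smul_apply] using hc) i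
  rw [LinearMap.smul_apply, smul_eq_zero] at h
  exact h.resolve_right (hQu i)

omit [Fintype X] [Nonempty X] in
/-- **`U(Φ) = Anti` is killed by no equivariant map that is non-zero on `Anti`**: if `Q` is equivariant, `Q u_1(Φ) = 0`
and `U(Φ) = Anti`, then `Q` vanishes on `Anti`. [cite: Gordon1999HodgeAVSurvey, §3 Theorem (proof)] -/
theorem forall_apply_eq_zero_of_antiSpan_eq {ρ : G} {Φ : Set X} (hU : antiSpan G Φ = antiWeights (E := X) ρ)
    (Q : (X → ℚ) →ₗ[ℚ] (X → ℚ)) (hQ : ∀ (g : G) (f : X → ℚ), Q (fun x => f (g⁻¹ • x)) = fun x => Q f (g⁻¹ • x))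
    (hQu : Q (antiVec Φ (1 : G)) = 0) : ∀ a ∈ antiWeights (E := X) ρ, Q a = 0 := by
  have hle : antiWeights (E := X) ρ ≤ LinearMap.ker Q := by
    rw [← hU, antiSpan]
    refine Submodule.span_le.2 ?_
    rintro _ ⟨g, rfl⟩
    change antiVec Φ g ∈ LinearMap.ker Q
    rw [LinearMap.mem_ker, antiVec_eq_antiVec_one_comp_smul Φ g, hQ, hQu]
    rfl
  exact fun a ha => hle ha

/-- **REDUCIBLE ODD WEIGHTS ⟹ CAPACITY AT MOST `n/2`.**  If some `G`-stable `W` with `0 ≠ W ≠ Anti`, `W ≤ Anti`, exists,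
every nondegenerate same-slot family of CM types for `ρ` has `2|I| ≤ |X|/2`: with the equivariant projection `Q` onto
`W`, `Anti = W ⊕ (Anti ∩ ker Q)`, and the families `(Q u_i)_i ⊆ W`, `((1 − Q) u_i)_i ⊆ Anti ∩ ker Q` are both linearly
independent (a member with `Q u_i = 0` or `Q u_i = u_i` would have `U(Φ_i)` inside a proper stable subspace).
[cite: Serre1977, §1.3 Thm. 1] [cite: Mai1989, §2 Prop. 1 (proof)] [cite: Gordon1999HodgeAVSurvey, 7.6.1 and 7.7] -/
theorem two_mul_card_le_of_reducible {ρ : G} (Φ : I → Set X) (h : ∀ i, IsCMTypeWith ρ (Φ i))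
    (W : Submodule ℚ (X → ℚ)) (hWA : W ≤ antiWeights (E := X) ρ) (hW0 : W ≠ ⊥) (hWne : W ≠ antiWeights (E := X) ρ)
    (hWst : ∀ (k : G) (f : X → ℚ), f ∈ W → (fun y => f (k • y)) ∈ W)
    (hnd : typeRank G (sigmaType (E := fun _ : I => X) Φ) = Fintype.card (Σ _ : I, X) / 2 + 1) :
    2 * Fintype.card I ≤ Fintype.card X / 2 := by
  rcases isEmpty_or_nonempty I with hI | hne
  · simp
  haveI := hne
  obtain ⟨i₀⟩ := hne
  set A : Submodule ℚ (X → ℚ) := antiWeights (E := X) ρ with hAdef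
  -- members are nondegenerate: `U(Φ_i) = Anti`
  have hmem : ∀ i, typeRank G (Φ i) = Fintype.card X / 2 + 1 := fun i =>
    typeRank_eq_of_typeRank_sigmaType_eq (E := fun _ : I => X) h hnd i
  have hU : ∀ i, antiSpan G (Φ i) = A := fun i => ((h i).typeRank_eq_iff_antiSpan_eq).1 (hmem i)
  have hadd := (forall_map_slotExt_le_iff_typeRank_sigmaType_eq (E := fun _ : I => X) h hmem).2 hnd
  have hfin : Module.finrank ℚ A = Fintype.card X / 2 := finrank_antiWeights_eq_of_typeRank_eq (h i₀) (hmem i₀)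
  -- the projection onto `W` and the complementary projection
  obtain ⟨Q, hQ, hQW, hQid⟩ := exists_equivariant_projection (G := G) W hWst
  let Q' : (X → ℚ) →ₗ[ℚ] (X → ℚ) := LinearMap.id - Q
  have hQ' : ∀ (g : G) (f : X → ℚ), Q' (fun x => f (g⁻¹ • x)) = fun x => Q' f (g⁻¹ • x) := fun g f => by
    simp only [Q', LinearMap.sub_apply, LinearMap.id_apply, hQ g f]
    rfl
  -- `W' = Anti ∩ ker Q`
  set W' : Submodule ℚ (X → ℚ) := A ⊓ LinearMap.ker Q with hW'def
  have hQ'A : ∀ a ∈ A, Q' a ∈ W' := fun a ha =>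
    ⟨A.sub_mem ha (hWA (hQW a)), by
      change Q (a - Q a) = 0
      rw [map_sub, hQid _ (hQW a), sub_self]⟩
  -- neither projection kills a type vector
  have hQu : ∀ i, Q (antiVec (Φ i) (1 : G)) ≠ 0 := fun i hzero => by
    obtain ⟨w, hw, hw0⟩ := (Submodule.ne_bot_iff W).1 hW0
    exact hw0 (by rw [← hQid w hw]; exact forall_apply_eq_zero_of_antiSpan_eq (hU i) Q hQ hzero w (hWA hw))
  have hQ'u : ∀ i, Q' (antiVec (Φ i) (1 : G)) ≠ 0 := fun i hzero => by
    apply hWne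
    refine le_antisymm hWA fun a ha => ?_
    have h1 : Q' a = 0 := forall_apply_eq_zero_of_antiSpan_eq (hU i) Q' hQ' hzero a ha
    have h2 : a = Q a := by
      have h3 : a - Q a = 0 := h1
      exact (sub_eq_zero.1 h3)
    rw [h2]
    exact hQW a
  -- two independent families
  have hliW : LinearIndependent ℚ fun i => (⟨Q (antiVec (Φ i) (1 : G)), hQW _⟩ : W) :=
    LinearIndependent.of_comp W.subtype
      (linearIndependent_apply_antiVec_of_forall_map_slotExt_le Φ hadd Q hQ hQu)
  have hliW' : LinearIndependent ℚ fun i =>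
      (⟨Q' (antiVec (Φ i) (1 : G)), hQ'A _ (antiVec_mem_antiWeights (h i) 1)⟩ : W') :=
    LinearIndependent.of_comp W'.subtype
      (linearIndependent_apply_antiVec_of_forall_map_slotExt_le Φ hadd Q' hQ' hQ'u)
  have h1 := hliW.fintype_card_le_finrank
  have h2 := hliW'.fintype_card_le_finrank
  -- `dim W + dim W' = dim Anti`
  have hsup : W ⊔ W' = A := by
    refine le_antisymm (sup_le hWA inf_le_left) fun a ha => Submodule.mem_sup.2 ?_
    exact ⟨Q a, hQW a, Q' a, hQ'A a ha, by simp only [Q', LinearMap.sub_apply, LinearMap.id_apply, add_sub_cancel]⟩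
  have hinf : W ⊓ W' = ⊥ := by
    rw [eq_bot_iff]
    intro w hw
    have h3 : Q w = 0 := hw.2.2
    rw [hQid w hw.1] at h3
    exact (Submodule.mem_bot ℚ).2 h3
  have hdim := Submodule.finrank_sup_add_finrank_inf_eq W W'
  rw [hsup, hinf, finrank_bot, add_zero, hfin] at hdim
  omega

end Reducible

/-! ### §3 Without multiplicity one: capacity `n/2`, irreducible or not -/

section Dichotomy

variable [DecidableEq I] [Fintype I] [Fintype X] [Nonempty X] [Nonempty I]

/-- **THE CAPACITY DICHOTOMY.**  If multiplicity one of the odd weights FAILS — some `G`-equivariant endomorphism of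
`ℚ^X` with `ρ`-odd values is not a multiple of `f ↦ f − f∘ρ` (for a CM field: (SC) fails, seat gen 54) — then EVERY
nondegenerate same-slot family of CM types for `ρ` has `2|I| ≤ |X|/2`: by F1b if the odd weights are irreducible, by
`two_mul_card_le_of_reducible` otherwise.  (Under multiplicity one the bound is `|I| ≤ |X|/2`, attained.)
[cite: Serre1977, §1.3 Thm. 1 and §2.2 Prop. 4] [cite: Mai1989, §2 Prop. 1 (proof)] [cite: Gordon1999HodgeAVSurvey, 7.7] -/
theorem two_mul_card_le_of_not_multiplicityOne' {ρ : G} (Φ : I → Set X) (h : ∀ i, IsCMTypeWith ρ (Φ i))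
    (hM1 : ¬ ∀ T : (X → ℚ) →ₗ[ℚ] (X → ℚ),
      (∀ (g : G) (f : X → ℚ), T (fun x => f (g⁻¹ • x)) = fun x => T f (g⁻¹ • x)) →
      (∀ (f : X → ℚ) (x : X), T f (ρ • x) = -T f x) → ∃ c : ℚ, ∀ f, T f = c • fun x => f x - f (ρ • x))
    (hnd : typeRank G (sigmaType (E := fun _ : I => X) Φ) = Fintype.card (Σ _ : I, X) / 2 + 1) :
    2 * Fintype.card I ≤ Fintype.card X / 2 := by
  by_cases hirr : ∀ W : Submodule ℚ (X → ℚ), W ≤ antiWeights (E := X) ρ → W ≠ ⊥ →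
      (∀ (k : G) (f : X → ℚ), f ∈ W → (fun y => f (k • y)) ∈ W) → W = antiWeights (E := X) ρ
  · exact two_mul_card_le_of_irreducible_of_not_multiplicityOne Φ h hirr hM1 hnd
  · push Not at hirr
    obtain ⟨W, hWA, hW0, hWst, hWne⟩ := hirr
    exact two_mul_card_le_of_reducible Φ h W hWA hW0 hWne hWst hnd

end Dichotomy

end Summit.HodgeConjecture.CorCM.IrrOdd

end
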